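import Summits.QuantumFields.YangMills.Theorems.FluctuationComparisonRegPrIntLSupTailReductionInt
import Literature.MathematicalPhysics.QuantumFieldTheory.Balaban1983to89.T3HeightwiseDensityBounds
import Literature.MathematicalPhysics.QuantumFieldTheory.Balaban1983to89.T3MinimiserStabilityReduction
import HarnessLib

/-!
# `FluctuationComparisonRegPrIntLSupTailFloorOfWreg` — THE SMALL-`J` FLOOR OF THE TAILSUP₁∘ LANE FROM WREG, MODULO ONE DOMINATION LETTER
# (crux `UnitScaleTilt.FluctuationComparisonRegPrIntL`, stmt-QuantumFields-20520; row TAILSUP₁∘ `WindowOddsSupDepthOneIntCan` of LINE g21-2 `tailsup_one`;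
# companion of ✓O v1.1 `…SupTailCoverUnionTwoRegime` ∕ ✓P `…SupTailCoverUnionFibreTail`, whose hypothesis carries the FLOOR conjunct discharged here)

Cell `ym3-torus` (YM ladder rung R3 = continuum SU(2) Yang–Mills on T³ — a RUNG, NOT the Clay problem: not d = 4, not infinite volume, not a mass gap);
width seat `ym3-torus-px21` (gen 13); helper `--supports stmt-QuantumFields-20520`.  THEOREMS ONLY (0 `def`, 0 `sorry`, no decl-local heartbeat budget).

WHAT.  After the LEAD's cure (α) (O v1.1, 2026-08-30) the TAILSUP₁∘ doors ask, at the finitely many levels `J < J₀(F, γ)` where no union bound can be small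
(the torus exponent `F.m` is free after `γ₁`), for a FLOOR: `∃ q > 0, ∀ B` measurable inside the INTERIOR window `W_J(c·b₀)`,
`ofReal q · Gibbs_K(D_{J,K}⁻¹B) ≤ Gibbs_K(D_{J,K}⁻¹B ∩ histGood(θBal b₀) K J)`.  This file proves it from the landed organ WREG
(✓`…Wreg.windowRegularity`: on the FULL window `W_J(b₀)` the restricted density `heightDensity^{histGood}` has a continuous canonical version, positive there)
MODULO ONE LETTER — a setwise domination of the descended law by product Haar on the interior window,
`Gibbs_K(D_{J,K}⁻¹B) ≤ ofReal C · dU_J(B)` for measurable `B ⊆ W_J(c·b₀)` — and names the two tree shapes of that letter: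
* §1 `exists_pos_le_of_continuousOn_of_isCompact` ∕ `exists_le_of_continuousOn_of_isCompact` (folklore: a function continuous and positive on an open set is bounded below by a positive constant on
  every compact subset) · `isCompact_closedWindow`, `setOf_plaqSmall_subset_closedWindow`, `closedWindow_subset_setOf_plaqSmall` (the CLOSED interior window
  `{∀ p, dist1 U(∂p) ≤ c·θ_J(b₀)}` is compact, contains the open interior window and, for `c < 1`, lies inside the open full window — `θBal_mul`, `θBal_pos`).
* §2 ★★`floor_of_regSet_of_dominated` — WREG's two clauses at `(J, K)` + the domination letter ⇒ the FLOOR with `q := Z_K⁻¹·m ∕ C`, `m` = the minimum of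
  `heightDensityCan^{histGood}` on the closed interior window (lit ✓`T3TiltDescent.map_descendTo_restrict_eq_withDensity`: the descended restricted law IS
  `dU_J.withDensity (Z_K⁻¹·heightDensity)`; `Node00.canonVersion_ae_eq`; `Node00.continuousOn_canonVersion`).
* §3 the letter in its two tree currencies: ★`dominated_of_heightwiseUpperBound` (lit `T3HeightwiseDensityBounds.HeightwiseUpperBound F γ` at height `J` — the
  upper half of [Balaban1985UV3] (5) p.256, a hypothesis-Prop of the tree, NOT discharged) and ★`dominated_of_fullWindowVersion` (a version `ρ` of `D_*Gibbs_K`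
  continuous on the FULL window `W_J(b₀)` — what a VERS-type hand supplies; TAILSUP₁∘'s own `ρ` is continuous on the interior window only and does NOT suffice);
  ★★★`floor_of_wreg` — the FLOOR under WREG's quantifier prefix (`∀ L b₀ p₀ ∃ γ₁ ∀ F γ ≤ γ₁ ∀ J K c`), the domination letter displayed as the one hypothesis.
HYP-SAT (★★OWNER RULING №42).  The domination letter is NOT in the tree unconditionally: it is an `L^∞` bound for the one-step (`K = J+1`) resp. `(K−J)`-step image law
of product Haar under the trunk's (0.4) `blockAvg ℰp` on the interior window; the tree has that image law's ABSOLUTE CONTINUITY (lit ✓`BlockAveragingEMLHaarAC.haarAC_avgFun_expMeanLogSU`)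
but no density bound.  So this door is SUPPLY for O v1.1∕P's FLOOR conjunct only together with that letter; it pins every small-`J` positivity of the lane (FLOOR,
LINE g22-2's PERS₁∘ at `K = J+1`, LINE g22-1's POS∘ per `K`) on ONE named `L^∞` letter.  Nothing here is `K`-uniform: `q` depends on `K` through `Z_K` and `C`.
HONEST SCOPE.  Measure theory + compactness over landed WREG; the domination letter, the moderate∕far rows and every organ (TAILSUP₁∘, MOD₁∘, LFR♯ᶜ∘, S2β, 20520,
`YM3TorusSU2`) are NOT proved; the Yang–Mills mass gap is NOT proved.
References: [Balaban1985UV3] (2) p. 256, (5) p. 256, (7) p. 257, (38)–(40) p. 266, (47) p. 267; [Balaban1987RG1] (0.4) p. 253; [Balaban1985Averaging] (10) p. 19.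
-/

noncomputable section

set_option autoImplicit false

open MeasureTheory Filter Topology Set
open scoped ENNReal NNReal BigOperators
open Literature.MathematicalPhysics.QuantumFieldTheory.Balaban1983to89
open Literature.MathematicalPhysics.QuantumFieldTheory.Balaban1983to89.T3ContinuumYM3Torus
open Literature.MathematicalPhysics.QuantumFieldTheory.Balaban1983to89.T3NestedUnitLaws
open Literature.MathematicalPhysics.QuantumFieldTheory.Balaban1983to89.T3UnitLawDensityEML
open Literature.MathematicalPhysics.QuantumFieldTheory.Balaban1983to89.T3UnitScaleTilt
open Literature.MathematicalPhysics.QuantumFieldTheory.Balaban1983to89.T3TiltDescent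
open Literature.MathematicalPhysics.QuantumFieldTheory.Balaban1983to89.T3HeightwiseDensityBounds
open Literature.MathematicalPhysics.QuantumFieldTheory.Balaban1983to89.Missing
open scoped Literature.MathematicalPhysics.QuantumFieldTheory.Balaban1983to89.T3OrbitAverage
open Summit.QuantumFields.YangMills.Theorems.FluctuationComparisonRegPrIntLWregGlue (heightDensityCan)
open Summit.QuantumFields.YangMills.Theorems.FluctuationComparisonRegPrIntLWregAssembly (isOpen_setOf_plaqSmall₂)

namespace Summit.QuantumFields.YangMills.Theorems.FluctuationComparisonRegPrIntLSupTailFloorOfWreg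

/-! ## §1 Compactness bookkeeping: positive lower bounds on compact sets; the closed interior window -/

section Compact

/-- A real function continuous on an open set `U` and positive there is bounded below by a POSITIVE constant on every compact `K ⊆ U`
(minimum on a nonempty compact set; `1` on the empty one). [folklore] -/
theorem exists_pos_le_of_continuousOn_of_isCompact {X : Type*} [TopologicalSpace X] {U K : Set X} (hK : IsCompact K) (hKU : K ⊆ U)
    {f : X → ℝ} (hf : ContinuousOn f U) (hpos : ∀ x ∈ U, 0 < f x) : ∃ m : ℝ, 0 < m ∧ ∀ x ∈ K, m ≤ f x := by
  rcases K.eq_empty_or_nonempty with hKe | hKne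
  · exact ⟨1, one_pos, fun x hx => by rw [hKe] at hx; exact absurd hx (Set.notMem_empty x)⟩
  · obtain ⟨x₀, hx₀K, hmin⟩ := hK.exists_isMinOn hKne (hf.mono hKU)
    exact ⟨f x₀, hpos x₀ (hKU hx₀K), fun x hx => hmin hx⟩

/-- A real function continuous on an open set `U` is bounded ABOVE on every compact `K ⊆ U` (maximum on a nonempty compact set; `0` on the empty one), and the
bound may be taken `≥ 1`. [folklore] -/
theorem exists_le_of_continuousOn_of_isCompact {X : Type*} [TopologicalSpace X] {U K : Set X} (hK : IsCompact K) (hKU : K ⊆ U)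
    {f : X → ℝ} (hf : ContinuousOn f U) : ∃ M : ℝ, 1 ≤ M ∧ ∀ x ∈ K, f x ≤ M := by
  rcases K.eq_empty_or_nonempty with hKe | hKne
  · exact ⟨1, le_rfl, fun x hx => by rw [hKe] at hx; exact absurd hx (Set.notMem_empty x)⟩
  · obtain ⟨x₀, hx₀K, hmax⟩ := hK.exists_isMaxOn hKne (hf.mono hKU)
    exact ⟨max (f x₀) 1, le_max_right _ _, fun x hx => (hmax hx).trans (le_max_left _ _)⟩

variable (F : T3Family) (γ b₀ p₀ c : ℝ) (J : ℕ)

/-- **THE CLOSED INTERIOR WINDOW IS COMPACT**: `{U | ∀ p, dist1(U(∂p)) ≤ c·θ_J(b₀)}` is a closed subset of the compact space of `SU(2)` fields.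
[cite: Balaban1987RG1, (0.18) p.255] -/
theorem isCompact_closedWindow :
    IsCompact {U : GaugeField (F.P J) 0 (Matrix.specialUnitaryGroup (Fin 2) ℂ) | ∀ p, dist1 (GaugeField.plaqHol U p) ≤ c * θBal F.L γ b₀ p₀ J} := by
  have hclosed : IsClosed {U : GaugeField (F.P J) 0 (Matrix.specialUnitaryGroup (Fin 2) ℂ) |
      ∀ p, dist1 (GaugeField.plaqHol U p) ≤ c * θBal F.L γ b₀ p₀ J} := by
    -- `U ↦ dist1(U(∂p))` is continuous (the tree's recipe behind ✓`isOpen_setOf_plaqSmall₂`)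
    have hdist : ∀ p : Plaq (F.P J) 0, Continuous fun U : GaugeField (F.P J) 0 (Matrix.specialUnitaryGroup (Fin 2) ℂ) =>
        dist1 (GaugeField.plaqHol U p) := fun p =>
      (UnitaryModel.continuous_opDist1.comp (Literature.MathematicalPhysics.QuantumLattice.continuous_fundamentalRep (Fin 2))).comp
        (B12ContinuousTransportInvarianceOn.continuous_plaqHol_SU (N := 2) p)
    simp only [Set.setOf_forall]
    exact isClosed_iInter fun p => isClosed_le (hdist p) continuous_const
  exact hclosed.isCompact

/-- The open interior window `{PlaqSmall (θBal L γ (c·b₀) p₀ J)}` lies inside the closed interior window (`θBal` is linear in the profile: lit `θBal_mul`).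
[cite: Balaban1985UV3, (7) p.257] -/
theorem setOf_plaqSmall_subset_closedWindow :
    {U : GaugeField (F.P J) 0 (Matrix.specialUnitaryGroup (Fin 2) ℂ) | PlaqSmall (θBal F.L γ (c * b₀) p₀ J) U} ⊆
      {U | ∀ p, dist1 (GaugeField.plaqHol U p) ≤ c * θBal F.L γ b₀ p₀ J} := by
  intro U hU p
  have h := hU p
  rw [T3InteriorExcision.θBal_mul] at h
  exact h.le

variable {γ b₀ c}

/-- For `c < 1` the closed interior window lies inside the OPEN full window `{PlaqSmall (θBal L γ b₀ p₀ J)}` (`c·θ < θ` since `θ > 0`: lit `θBal_pos`,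
`0 < γ ≤ 1`, `0 < b₀`). [cite: Balaban1985UV3, (7) p.257] -/
theorem closedWindow_subset_setOf_plaqSmall (hγ : 0 < γ) (hγ1 : γ ≤ 1) (hb₀ : 0 < b₀) (hc1 : c < 1) :
    {U : GaugeField (F.P J) 0 (Matrix.specialUnitaryGroup (Fin 2) ℂ) | ∀ p, dist1 (GaugeField.plaqHol U p) ≤ c * θBal F.L γ b₀ p₀ J} ⊆
      {U | PlaqSmall (θBal F.L γ b₀ p₀ J) U} := by
  intro U hU p
  have hθ : 0 < θBal F.L γ b₀ p₀ J := T3MinimiserStabilityReduction.θBal_pos (le_of_lt F.hL.2) hγ hγ1 hb₀ p₀ J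
  have hlt : c * θBal F.L γ b₀ p₀ J < θBal F.L γ b₀ p₀ J := by
    have := mul_lt_mul_of_pos_right hc1 hθ
    rwa [one_mul] at this
  exact (hU p).trans_lt hlt

end Compact

/-! ## §2 THE FLOOR at one `(J, K)` from WREG's two clauses and the domination letter -/

section Floor

variable (F : T3Family) {γ : ℝ} (b₀ p₀ c : ℝ) {J K : ℕ} (hJK : J ≤ K)

/-- ★★ **THE SMALL-`J` FLOOR FROM WINDOW REGULARITY, MODULO DOMINATION.**  At one `(J, K)` (`0 < γ ≤ 1`, `0 < b₀`, `0 < c < 1`): if the FULL window `W_J(b₀)` lies in the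
regular set of `heightDensity^{histGood(b₀) K J}` and the canonical version is positive there (WREG's two clauses), and if the descended law is DOMINATED by product Haar on
the interior window — `Gibbs_K(D_{J,K}⁻¹B) ≤ ofReal C · dU_J(B)` for measurable `B ⊆ W_J(c·b₀)`, `0 < C` — then there is `q > 0` with
`ofReal q · Gibbs_K(D_{J,K}⁻¹B) ≤ Gibbs_K(D_{J,K}⁻¹B ∩ histGood(b₀) K J)` for every such `B`.  Proof: `m := min` of `heightDensityCan^{histGood}` on the COMPACT closed interior
window (§1; continuity on `regSet` by lit `Node00.continuousOn_canonVersion`), `Gibbs_K(D⁻¹B ∩ histGood) = ∫⁻_B ofReal(Z_K⁻¹·heightDensity^{histGood}) d dU_J` (lit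
✓`map_descendTo_restrict_eq_withDensity`) `≥ ofReal(Z_K⁻¹m)·dU_J(B)` (`Node00.canonVersion_ae_eq`), and `q := Z_K⁻¹m∕C`. [cite: Balaban1985UV3, (2) p.256, (7) p.257 and (38)-(40) p.266] -/
theorem floor_of_regSet_of_dominated (hγ : 0 < γ) (hγ1 : γ ≤ 1) (hb₀ : 0 < b₀) (hc1 : c < 1)
    (hreg : {U : GaugeField (F.P J) 0 (Matrix.specialUnitaryGroup (Fin 2) ℂ) | PlaqSmall (θBal F.L γ b₀ p₀ J) U} ⊆
      Node00.regSet (fieldMeasure (F.P J) 0 (Matrix.specialUnitaryGroup (Fin 2) ℂ)) (heightDensity F γ hJK (histGood F ℰp (θBal F.L γ b₀ p₀) K J)))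
    (hpos : ∀ U : GaugeField (F.P J) 0 (Matrix.specialUnitaryGroup (Fin 2) ℂ), PlaqSmall (θBal F.L γ b₀ p₀ J) U →
      0 < heightDensityCan F γ hJK (histGood F ℰp (θBal F.L γ b₀ p₀) K J) U)
    {C : ℝ} (hC : 0 < C)
    (hdom : ∀ B : Set (GaugeField (F.P J) 0 (Matrix.specialUnitaryGroup (Fin 2) ℂ)), MeasurableSet B →
      B ⊆ {U | PlaqSmall (θBal F.L γ (c * b₀) p₀ J) U} →
      gibbsK F ℰp γ K (descendTo F ℰp J K hJK ⁻¹' B) ≤ ENNReal.ofReal C * fieldMeasure (F.P J) 0 (Matrix.specialUnitaryGroup (Fin 2) ℂ) B) :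
    ∃ q : ℝ, 0 < q ∧ ∀ B : Set (GaugeField (F.P J) 0 (Matrix.specialUnitaryGroup (Fin 2) ℂ)), MeasurableSet B →
      B ⊆ {U | PlaqSmall (θBal F.L γ (c * b₀) p₀ J) U} →
      ENNReal.ofReal q * gibbsK F ℰp γ K (descendTo F ℰp J K hJK ⁻¹' B) ≤
        gibbsK F ℰp γ K (descendTo F ℰp J K hJK ⁻¹' B ∩ histGood F ℰp (θBal F.L γ b₀ p₀) K J) := by
  haveI := B12ContinuousTransportInvariance.isOpenPosMeasure_fieldMeasure_SU (N := 2) (F.P J) 0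
  set μ := fieldMeasure (F.P J) 0 (Matrix.specialUnitaryGroup (Fin 2) ℂ) with hμ
  set G := histGood F ℰp (θBal F.L γ b₀ p₀) K J with hG
  set W : Set (GaugeField (F.P J) 0 (Matrix.specialUnitaryGroup (Fin 2) ℂ)) := {U | PlaqSmall (θBal F.L γ b₀ p₀ J) U} with hW
  set Kc : Set (GaugeField (F.P J) 0 (Matrix.specialUnitaryGroup (Fin 2) ℂ)) :=
    {U | ∀ p, dist1 (GaugeField.plaqHol U p) ≤ c * θBal F.L γ b₀ p₀ J} with hKc
  set Z : ℝ := partitionFn (G := Matrix.specialUnitaryGroup (Fin 2) ℂ) (F.P K) ((F.scheme ℰp γ).β K) with hZ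
  have hZpos : 0 < Z := partitionFn_pos' _ (F.scheme_β_nonneg ℰp hγ.le K)
  have hGm : MeasurableSet G := measurableSet_histGood F ℰp measurableE_ℰp _ K J
  have hD : Measurable (descendTo F ℰp J K hJK) := measurable_descendTo F ℰp measurableE_ℰp hJK
  -- WREG: the canonical version of `heightDensity^{histGood}` is continuous on the open full window and positive there
  have hcG : ContinuousOn (heightDensityCan F γ hJK G) W := by
    have : heightDensityCan F γ hJK G = Node00.canonVersion μ (heightDensity F γ hJK G) := rfl
    rw [this]
    exact Node00.continuousOn_canonVersion.mono hreg
  -- its minimum on the compact closed interior window is positive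
  have hKcW : Kc ⊆ W := closedWindow_subset_setOf_plaqSmall F p₀ J hγ hγ1 hb₀ hc1
  obtain ⟨m, hm, hmle⟩ := exists_pos_le_of_continuousOn_of_isCompact (isCompact_closedWindow F γ b₀ p₀ c J) hKcW hcG hpos
  refine ⟨Z⁻¹ * m / C, by positivity, fun B hB hBW => ?_⟩
  have hBK : B ⊆ Kc := hBW.trans (setOf_plaqSmall_subset_closedWindow F γ b₀ p₀ c J)
  -- the good mass above `B` as an integral of the restricted height density
  have hgood : gibbsK F ℰp γ K (descendTo F ℰp J K hJK ⁻¹' B ∩ G) =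
      ∫⁻ V in B, ENNReal.ofReal (Z⁻¹ * heightDensity F γ hJK G V) ∂μ := by
    have hmap := map_descendTo_restrict_eq_withDensity F hJK hGm hγ.le
    have h1 : gibbsK F ℰp γ K (descendTo F ℰp J K hJK ⁻¹' B ∩ G) =
        (Measure.map (descendTo F ℰp J K hJK) ((gibbsK F ℰp γ K).restrict G)) B := by
      rw [Measure.map_apply hD hB, Measure.restrict_apply (hB.preimage hD)]
    rw [h1, hmap, withDensity_apply _ hB]
  -- lower bound of that integral by `ofReal (Z⁻¹ m) · μ B`
  have hlow : ENNReal.ofReal (Z⁻¹ * m) * μ B ≤ ∫⁻ V in B, ENNReal.ofReal (Z⁻¹ * heightDensity F γ hJK G V) ∂μ := by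
    have hae : ∀ᵐ V ∂μ.restrict B, ENNReal.ofReal (Z⁻¹ * m) ≤ ENNReal.ofReal (Z⁻¹ * heightDensity F γ hJK G V) := by
      have hcan : ∀ᵐ V ∂μ.restrict B, heightDensityCan F γ hJK G V = heightDensity F γ hJK G V :=
        ae_restrict_of_ae (Node00.canonVersion_ae_eq (μ := μ) (f := heightDensity F γ hJK G))
      have hinB : ∀ᵐ V ∂μ.restrict B, V ∈ B := (ae_restrict_iff' hB).2 (Eventually.of_forall fun V hV => hV)
      filter_upwards [hcan, hinB] with V hV hVB
      refine ENNReal.ofReal_le_ofReal (mul_le_mul_of_nonneg_left ?_ (inv_nonneg.mpr hZpos.le))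
      rw [← hV]
      exact hmle V (hBK hVB)
    calc ENNReal.ofReal (Z⁻¹ * m) * μ B = ∫⁻ _V in B, ENNReal.ofReal (Z⁻¹ * m) ∂μ := (setLIntegral_const B _).symm
      _ ≤ ∫⁻ V in B, ENNReal.ofReal (Z⁻¹ * heightDensity F γ hJK G V) ∂μ := lintegral_mono_ae hae
  -- assemble: `q · Gibbs(D⁻¹B) ≤ q · C · μ B = Z⁻¹ m · μ B ≤ Gibbs(D⁻¹B ∩ G)`
  have hqC : ENNReal.ofReal (Z⁻¹ * m / C) * ENNReal.ofReal C = ENNReal.ofReal (Z⁻¹ * m) := by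
    rw [← ENNReal.ofReal_mul (by positivity)]
    congr 1
    field_simp
  calc ENNReal.ofReal (Z⁻¹ * m / C) * gibbsK F ℰp γ K (descendTo F ℰp J K hJK ⁻¹' B)
      ≤ ENNReal.ofReal (Z⁻¹ * m / C) * (ENNReal.ofReal C * μ B) := mul_le_mul' le_rfl (hdom B hB hBW)
    _ = ENNReal.ofReal (Z⁻¹ * m) * μ B := by rw [← mul_assoc, hqC]
    _ ≤ ∫⁻ V in B, ENNReal.ofReal (Z⁻¹ * heightDensity F γ hJK G V) ∂μ := hlow
    _ = gibbsK F ℰp γ K (descendTo F ℰp J K hJK ⁻¹' B ∩ G) := hgood.symm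

end Floor

/-! ## §3 The domination letter in its two tree currencies, and the floor under WREG's quantifier prefix -/

section Letter

variable (F : T3Family) {γ : ℝ} (b₀ p₀ c : ℝ) {J K : ℕ} (hJK : J ≤ K)

/-- ★ **DOMINATION FROM THE HEIGHTWISE UPPER STABILITY BOUND** (lit `T3HeightwiseDensityBounds.HeightwiseUpperBound`, the upper half of [Balaban1985UV3] (5) at every
height — a hypothesis-Prop of the tree, NOT discharged here): `Gibbs_K(D_{J,K}⁻¹B) ≤ ofReal(max C 1)·dU_J(B)` for EVERY measurable `B` (no window needed), `C` the
height-`J` constant.  HYP-SAT: conditional of record — the letter is CMP 102 Thm 1's upper bound. [cite: Balaban1985UV3, (5) p.256] -/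
theorem dominated_of_heightwiseUpperBound (hγ : 0 ≤ γ) (h : HeightwiseUpperBound F γ) :
    ∃ C : ℝ, 0 < C ∧ ∀ (K : ℕ) (hJK : J ≤ K) (B : Set (GaugeField (F.P J) 0 (Matrix.specialUnitaryGroup (Fin 2) ℂ))), MeasurableSet B →
      gibbsK F ℰp γ K (descendTo F ℰp J K hJK ⁻¹' B) ≤ ENNReal.ofReal C * fieldMeasure (F.P J) 0 (Matrix.specialUnitaryGroup (Fin 2) ℂ) B := by
  obtain ⟨C, hC0, hdom⟩ := map_descendTo_le_smul_fieldMeasure (F := F) hγ h J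
  refine ⟨max C 1, lt_of_lt_of_le one_pos (le_max_right _ _), fun K hJK B hB => ?_⟩
  have hD : Measurable (descendTo F ℰp J K hJK) := measurable_descendTo F ℰp measurableE_ℰp hJK
  have h1 : gibbsK F ℰp γ K (descendTo F ℰp J K hJK ⁻¹' B) = (Measure.map (descendTo F ℰp J K hJK) (gibbsK F ℰp γ K)) B := by
    rw [Measure.map_apply hD hB]
  rw [h1]
  calc (Measure.map (descendTo F ℰp J K hJK) (gibbsK F ℰp γ K)) B
      ≤ (ENNReal.ofReal C • fieldMeasure (F.P J) 0 (Matrix.specialUnitaryGroup (Fin 2) ℂ)) B := hdom K hJK B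
    _ = ENNReal.ofReal C * fieldMeasure (F.P J) 0 (Matrix.specialUnitaryGroup (Fin 2) ℂ) B := by rw [Measure.smul_apply, smul_eq_mul]
    _ ≤ ENNReal.ofReal (max C 1) * fieldMeasure (F.P J) 0 (Matrix.specialUnitaryGroup (Fin 2) ℂ) B :=
        mul_le_mul' (ENNReal.ofReal_le_ofReal (le_max_left _ _)) le_rfl

/-- ★ **DOMINATION FROM A FULL-WINDOW CONTINUOUS VERSION** of the descended law: if `D_*Gibbs_K = dU_J.withDensity (ofReal ∘ ρ)` with `ρ` continuous on the OPEN FULL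
window `W_J(b₀)` (`0 < γ ≤ 1`, `0 < b₀`, `c < 1`), then on the interior window `Gibbs_K(D⁻¹B) ≤ ofReal M·dU_J(B)` with `M ≥ 1` the maximum of `ρ` on the compact closed
interior window.  NOTE: TAILSUP₁∘'s own `ρ` is assumed continuous on the INTERIOR window only — that does not bound `ρ` at the window's edge and does NOT give this
letter. [cite: Balaban1985UV3, (2) p.256 and (7) p.257] -/
theorem dominated_of_fullWindowVersion (hγ : 0 < γ) (hγ1 : γ ≤ 1) (hb₀ : 0 < b₀) (hc1 : c < 1)
    (ρ : GaugeField (F.P J) 0 (Matrix.specialUnitaryGroup (Fin 2) ℂ) → ℝ)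
    (hlaw : Measure.map (descendTo F ℰp J K hJK) (gibbsK F ℰp γ K) =
      (fieldMeasure (F.P J) 0 (Matrix.specialUnitaryGroup (Fin 2) ℂ)).withDensity (fun U => ENNReal.ofReal (ρ U)))
    (hρc : ContinuousOn ρ {U | PlaqSmall (θBal F.L γ b₀ p₀ J) U}) :
    ∃ C : ℝ, 0 < C ∧ ∀ B : Set (GaugeField (F.P J) 0 (Matrix.specialUnitaryGroup (Fin 2) ℂ)), MeasurableSet B →
      B ⊆ {U | PlaqSmall (θBal F.L γ (c * b₀) p₀ J) U} →
      gibbsK F ℰp γ K (descendTo F ℰp J K hJK ⁻¹' B) ≤ ENNReal.ofReal C * fieldMeasure (F.P J) 0 (Matrix.specialUnitaryGroup (Fin 2) ℂ) B := by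
  set μ := fieldMeasure (F.P J) 0 (Matrix.specialUnitaryGroup (Fin 2) ℂ) with hμ
  have hKcW := closedWindow_subset_setOf_plaqSmall F p₀ J hγ hγ1 hb₀ hc1
  obtain ⟨M, hM1, hMle⟩ := exists_le_of_continuousOn_of_isCompact (isCompact_closedWindow F γ b₀ p₀ c J) hKcW hρc
  have hD : Measurable (descendTo F ℰp J K hJK) := measurable_descendTo F ℰp measurableE_ℰp hJK
  refine ⟨M, lt_of_lt_of_le one_pos hM1, fun B hB hBW => ?_⟩
  have hBK := hBW.trans (setOf_plaqSmall_subset_closedWindow F γ b₀ p₀ c J)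
  have h1 : gibbsK F ℰp γ K (descendTo F ℰp J K hJK ⁻¹' B) = ∫⁻ V in B, ENNReal.ofReal (ρ V) ∂μ := by
    rw [← Measure.map_apply hD hB, hlaw, withDensity_apply _ hB]
  rw [h1]
  have hae : ∀ᵐ V ∂μ.restrict B, ENNReal.ofReal (ρ V) ≤ ENNReal.ofReal M :=
    (ae_restrict_iff' hB).2 (Eventually.of_forall fun V hV => ENNReal.ofReal_le_ofReal (hMle V (hBK hV)))
  calc ∫⁻ V in B, ENNReal.ofReal (ρ V) ∂μ ≤ ∫⁻ _V in B, ENNReal.ofReal M ∂μ := lintegral_mono_ae hae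
    _ = ENNReal.ofReal M * μ B := setLIntegral_const B _

end Letter

/-- ★★★ **THE FLOOR OF THE TAILSUP₁∘ LANE FROM WREG, UNDER WREG'S QUANTIFIER PREFIX, THE DOMINATION LETTER DISPLAYED.**  For every block size `L` and profile
`b₀, p₀ > 0` there is `γ₁ > 0` (✓`windowRegularity`'s, capped at `1`) such that for every family `F` with `F.L = L`, every `0 < γ ≤ γ₁`, every `J ≤ K`, every
fraction `0 < c < 1` and every `C > 0`: IF the descended law is dominated by product Haar on the interior window, `Gibbs_K(D_{J,K}⁻¹B) ≤ ofReal C·dU_J(B)` for measurable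
`B ⊆ W_J(c·b₀)` (§3: from lit `HeightwiseUpperBound`, or from a full-window continuous version), THEN `∃ q > 0` with
`ofReal q·Gibbs_K(D_{J,K}⁻¹B) ≤ Gibbs_K(D_{J,K}⁻¹B ∩ histGood(θBal b₀) K J)` for all such `B` — at `K = J + 1` exactly the FLOOR conjunct of ✓O v1.1 ∕ ✓P (there for
`J < J₀`), and the shape of LINE g22-2's PERS₁∘-class positivity; `q` depends on `K` (nothing `K`-uniform is claimed). [cite: Balaban1985UV3, (2) p.256, (5) p.256, (7) p.257 and (38)-(40) p.266] -/
theorem floor_of_wreg :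
    ∀ (L : ℕ) (b₀ p₀ : ℝ), 0 < b₀ → 0 < p₀ → ∃ γ₁ : ℝ, 0 < γ₁ ∧ ∀ (F : T3Family) (γ : ℝ), F.L = L → 0 < γ → γ ≤ γ₁ →
      ∀ (J K : ℕ) (hJK : J ≤ K) (c : ℝ), 0 < c → c < 1 → ∀ (C : ℝ), 0 < C →
        (∀ B : Set (GaugeField (F.P J) 0 (Matrix.specialUnitaryGroup (Fin 2) ℂ)), MeasurableSet B →
          B ⊆ {U | PlaqSmall (θBal F.L γ (c * b₀) p₀ J) U} →
          gibbsK F ℰp γ K (descendTo F ℰp J K hJK ⁻¹' B) ≤ ENNReal.ofReal C * fieldMeasure (F.P J) 0 (Matrix.specialUnitaryGroup (Fin 2) ℂ) B) →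
        ∃ q : ℝ, 0 < q ∧ ∀ B : Set (GaugeField (F.P J) 0 (Matrix.specialUnitaryGroup (Fin 2) ℂ)), MeasurableSet B →
          B ⊆ {U | PlaqSmall (θBal F.L γ (c * b₀) p₀ J) U} →
          ENNReal.ofReal q * gibbsK F ℰp γ K (descendTo F ℰp J K hJK ⁻¹' B) ≤
            gibbsK F ℰp γ K (descendTo F ℰp J K hJK ⁻¹' B ∩ histGood F ℰp (θBal F.L γ b₀ p₀) K J) := by
  intro L b₀ p₀ hb₀ hp₀
  obtain ⟨γ₂, hγ₂, hW⟩ := FluctuationComparisonRegPrIntLWreg.windowRegularity L b₀ p₀ hb₀ hp₀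
  refine ⟨min γ₂ 1, lt_min hγ₂ one_pos, fun F γ hFL hγ hγle J K hJK c _hc0 hc1 C hC hdom => ?_⟩
  have hγ2 : γ ≤ γ₂ := hγle.trans (min_le_left _ _)
  have hγ1 : γ ≤ 1 := hγle.trans (min_le_right _ _)
  obtain ⟨hreg, hpos⟩ := hW F γ hFL hγ hγ2 J K hJK γ hγ
  exact floor_of_regSet_of_dominated F b₀ p₀ c hJK hγ hγ1 hb₀ hc1 hreg hpos hC hdom

end Summit.QuantumFields.YangMills.Theorems.FluctuationComparisonRegPrIntLSupTailFloorOfWreg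

end
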